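import Summits.CriticalPhenomena.PercolationContinuityZ3.Theorems.PercNearOneGluingNoHeavyQuantTwoBigChain
import HarnessLib

/-!
# QUANT lane R8, Conjecture DIB\* — the two-big certificate, cell `HL/C3`

builds on p205010 (kernel theorem, internal audit signed; external expert review pending)

Support file (`--supports stmt-CriticalPhenomena-4575`), QUANT lane census-1 (gen 17); memo
`run/shared/lean/prim/quant/prim-quant-census-1/TWOBIG-G17.md`.  Theorems only, no definitions, no sorries, standard axioms.
Coordinates `y = 1 − x`, `uᵢ = αᵢφᵢ`, `vᵢ = αᵢ(1 − φᵢ)` (`αᵢ = bᵢ/j`, `φᵢ` = credit rate of big `i`); the three `tbcBlock_*` lemmas are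
LP-found Handelman certificates (products of the cell's defining inequalities, replayed by `linarith`) of a separable budget split
`c₁ + c₂ + c₀ = (1−y)α₁α₂ − P₁P₂`, `cₖ·Dₖ ≤ Bₖ·Nₖ`; `tbcCell_*` combines them into the reduced inequality of the cell
(items in product form).  [this work]; the gluing rows served [cite: KozmaNitzan2024, Conjecture 3 (p. 15)].
-/

namespace Summit.CriticalPhenomena.PercolationContinuityZ3.Theorems

namespace Quant

namespace IndepBlob

set_option maxHeartbeats 1000000 in
set_option maxRecDepth 8192 in
/-- Two-big cell `HL/C3`, block 1: Handelman support (63 products; kit LP; split polynomial rounded to denominators ≤ 256). [this work] -/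
theorem tbcBlock_HL_C3_1 (y u₁ v₁ u₂ v₂ : ℝ) (_hy : 0 ≤ y) (_hhy : 0 ≤ 1 / 2 - y) (_hu1 : 0 ≤ u₁) (_hv1 : 0 ≤ v₁) (_hu2 : 0 ≤ u₂) (_hv2 : 0 ≤ v₂)
    (_ha1 : 0 ≤ 1 - u₁ - v₁) (_hb1 : 0 ≤ u₁ + v₁ - 1 / 2) (_ha2 : 0 ≤ 1 - u₂ - v₂) (_hb2 : 0 ≤ u₂ + v₂ - 1 / 2) (_ht1 : 0 ≤ u₁ * y - (1 - y) * v₁)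
    (_ht2 : 0 ≤ (1 - y) * v₂ - u₂ * y) (_hr1 : 0 ≤ (2 - y) * (1 - u₁ - v₁) - (2 - u₁ - u₂)) :
    (-13 / 128 - 11 / 16 * y + 85 / 128 * u₁ + 71 / 256 * v₁ + 9 / 256 * u₂ + 1 / 2 * v₂) * ((2 - u₁ - u₂) - (1 - y) * (1 - u₁ - v₁))
      ≤ (u₁ * ((u₂ + v₂) * (2 - y) - u₂)) * ((1 - y) * (1 + v₁ - u₂)) := by
  linarith [
    mul_nonneg (mul_nonneg (mul_nonneg _hy _hy) _hu1) _ha2, mul_nonneg (mul_nonneg _hy _hy) _hv1,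
    mul_nonneg (mul_nonneg (mul_nonneg (mul_nonneg _hy _hy) _hv1) _hv1) _hb2, mul_nonneg (mul_nonneg (mul_nonneg _hy _hy) _hv1) _hb2,
    mul_nonneg (mul_nonneg _hy _hy) _ha1, mul_nonneg (mul_nonneg (mul_nonneg _hy _hy) _ha1) _ha1,
    mul_nonneg (mul_nonneg (mul_nonneg _hy _hhy) _hu1) _hb1, mul_nonneg (mul_nonneg (mul_nonneg _hy _hu1) _hu2) _hb1,
    mul_nonneg (mul_nonneg _hy _hv1) _hv1, mul_nonneg (mul_nonneg _hy _hv1) _ha1, mul_nonneg (mul_nonneg (mul_nonneg _hy _hu2) _hb1) _hb1,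
    mul_nonneg (mul_nonneg _hy _hv2) _ha2, mul_nonneg (mul_nonneg _hy _ha1) _ha2, mul_nonneg (mul_nonneg _hy _hb1) _hb1,
    mul_nonneg (mul_nonneg _hy _hb1) _hr1, mul_nonneg (mul_nonneg _hy _ha2) _ha2, mul_nonneg (mul_nonneg _hy _hb2) _hr1,
    mul_nonneg (mul_nonneg (mul_nonneg (mul_nonneg _hhy _hhy) _hu1) _hu1) _ha2, mul_nonneg (mul_nonneg (mul_nonneg _hhy _hhy) _hu1) _hv1,
    mul_nonneg (mul_nonneg (mul_nonneg (mul_nonneg _hhy _hhy) _hu1) _hb1) _ha2,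
    mul_nonneg (mul_nonneg (mul_nonneg (mul_nonneg _hhy _hhy) _hu1) _ha2) _hb2, mul_nonneg (mul_nonneg (mul_nonneg _hhy _hhy) _ha2) _hb2,
    mul_nonneg (mul_nonneg _hhy _hu1) _hv1, mul_nonneg (mul_nonneg (mul_nonneg _hhy _hu1) _hv1) _hb2,
    mul_nonneg (mul_nonneg (mul_nonneg _hhy _hu1) _hv1) _ht2, mul_nonneg (mul_nonneg (mul_nonneg _hhy _hu1) _hv2) _ht2,
    mul_nonneg (mul_nonneg (mul_nonneg _hhy _hu1) _ha1) _ht2, mul_nonneg (mul_nonneg (mul_nonneg _hhy _hu1) _hb1) _ha2,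
    mul_nonneg (mul_nonneg (mul_nonneg _hhy _hu1) _ha2) _hb2, mul_nonneg (mul_nonneg (mul_nonneg _hhy _hu1) _ha2) _ht2,
    mul_nonneg (mul_nonneg (mul_nonneg _hhy _hu1) _ha2) _hr1, mul_nonneg (mul_nonneg _hhy _hv1) _hb1, mul_nonneg (mul_nonneg _hhy _hv1) _hr1,
    mul_nonneg (mul_nonneg _hhy _hv2) _hb1, mul_nonneg (mul_nonneg (mul_nonneg _hhy _ha1) _hb1) _ht2, mul_nonneg (mul_nonneg _hhy _ha2) _hr1,
    mul_nonneg (mul_nonneg (mul_nonneg _hu1 _hb1) _hb1) _ha2, mul_nonneg (mul_nonneg _hu1 _ha2) _hb2, mul_nonneg (mul_nonneg _hu1 _ha2) _hr1,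
    mul_nonneg (mul_nonneg _hu1 _ht2) _ht2, mul_nonneg (mul_nonneg _hv1 _hu2) _hb1, mul_nonneg (mul_nonneg _hv1 _hv2) _ht1,
    mul_nonneg (mul_nonneg (mul_nonneg _hv1 _ha1) _ha1) _ha2, mul_nonneg (mul_nonneg _hv1 _ha1) _ha2, mul_nonneg _hv1 _ha2,
    mul_nonneg (mul_nonneg _hv1 _ha2) _ha2, mul_nonneg (mul_nonneg _hv1 _hb2) _ht1, mul_nonneg (mul_nonneg _hv1 _hb2) _hr1, mul_nonneg _hv1 _ht1,
    mul_nonneg (mul_nonneg _hv1 _ht1) _ht2, mul_nonneg (mul_nonneg _hv1 _ht2) _hr1, mul_nonneg (mul_nonneg _hv2 _hb1) _hb1, mul_nonneg _hv2 _hr1,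
    mul_nonneg (mul_nonneg (mul_nonneg _ha1 _ha1) _ha1) _ha2, mul_nonneg (mul_nonneg _ha1 _ht1) _ht2, mul_nonneg (mul_nonneg _ha1 _ht2) _hr1,
    mul_nonneg (mul_nonneg _hb1 _hb1) _ha2, mul_nonneg (mul_nonneg _hb1 _ha2) _hb2, mul_nonneg (mul_nonneg _hb1 _ha2) _hr1, mul_nonneg _hb1 _ht2,
    mul_nonneg _ha2 _ht2, mul_nonneg _ht1 _ht2, mul_nonneg _ht2 _ht2]

set_option maxHeartbeats 1000000 in
set_option maxRecDepth 8192 in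
/-- Two-big cell `HL/C3`, block 2: Handelman support (83 products; kit LP; split polynomial rounded to denominators ≤ 256). [this work] -/
theorem tbcBlock_HL_C3_2 (y u₁ v₁ u₂ v₂ : ℝ) (_hy : 0 ≤ y) (_hhy : 0 ≤ 1 / 2 - y) (_hu1 : 0 ≤ u₁) (_hv1 : 0 ≤ v₁) (_hu2 : 0 ≤ u₂) (_hv2 : 0 ≤ v₂)
    (_ha1 : 0 ≤ 1 - u₁ - v₁) (_hb1 : 0 ≤ u₁ + v₁ - 1 / 2) (_ha2 : 0 ≤ 1 - u₂ - v₂) (_hb2 : 0 ≤ u₂ + v₂ - 1 / 2) (_ht1 : 0 ≤ u₁ * y - (1 - y) * v₁)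
    (_ht2 : 0 ≤ (1 - y) * v₂ - u₂ * y) (_hr1 : 0 ≤ (2 - y) * (1 - u₁ - v₁) - (2 - u₁ - u₂)) :
    (3 / 32 - 67 / 128 * y - 3 / 128 * u₁ + 1 / 16 * v₁ + 139 / 256 * u₂ + 69 / 128 * v₂) * (y * (2 - u₁ - u₂) + (1 + v₂ - u₁) ^ 2)
      ≤ ((u₂ + v₂) * (1 - y) ^ 2 + y * u₂) * (1 + v₂ - u₁) ^ 2 := by
  linarith [
    mul_nonneg (mul_nonneg (mul_nonneg (mul_nonneg _hy _hy) _hhy) _ha1) _ha2,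
    mul_nonneg (mul_nonneg (mul_nonneg (mul_nonneg _hy _hy) _hu1) _ha1) _ha1,
    mul_nonneg (mul_nonneg (mul_nonneg (mul_nonneg _hy _hy) _hu1) _ha2) _ha2, mul_nonneg (mul_nonneg _hy _hy) _hv1,
    mul_nonneg (mul_nonneg (mul_nonneg (mul_nonneg _hy _hy) _hv1) _ha1) _hb1, mul_nonneg (mul_nonneg _hy _hy) _hv2,
    mul_nonneg (mul_nonneg (mul_nonneg _hy _hy) _hv2) _ha2, mul_nonneg (mul_nonneg _hy _hy) _ha1, mul_nonneg (mul_nonneg _hy _hhy) _hr1,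
    mul_nonneg (mul_nonneg (mul_nonneg _hy _hu1) _hv1) _hb2, mul_nonneg (mul_nonneg (mul_nonneg _hy _hu1) _hv1) _ht2,
    mul_nonneg (mul_nonneg (mul_nonneg _hy _hu1) _hv2) _ha1, mul_nonneg (mul_nonneg (mul_nonneg _hy _hu1) _hv2) _hb2,
    mul_nonneg (mul_nonneg (mul_nonneg _hy _hu1) _hv2) _ht2, mul_nonneg (mul_nonneg (mul_nonneg _hy _hu1) _ha1) _ht2,
    mul_nonneg (mul_nonneg (mul_nonneg _hy _hu1) _ha1) _hr1, mul_nonneg (mul_nonneg (mul_nonneg _hy _hu1) _ha2) _ht1,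
    mul_nonneg (mul_nonneg _hy _hu1) _hr1, mul_nonneg (mul_nonneg _hy _hv1) _ht1, mul_nonneg (mul_nonneg _hy _hu2) _hr1,
    mul_nonneg (mul_nonneg (mul_nonneg _hy _hv2) _hv2) _ha2, mul_nonneg (mul_nonneg (mul_nonneg _hy _hv2) _ha1) _ha2,
    mul_nonneg (mul_nonneg (mul_nonneg _hy _hv2) _hb2) _hr1, mul_nonneg (mul_nonneg (mul_nonneg _hy _ha1) _ha1) _ha2,
    mul_nonneg (mul_nonneg (mul_nonneg _hy _ha1) _hb1) _ht2, mul_nonneg (mul_nonneg (mul_nonneg _hy _ha2) _ha2) _ha2,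
    mul_nonneg (mul_nonneg (mul_nonneg _hy _hb2) _hb2) _hr1, mul_nonneg (mul_nonneg _hy _hb2) _hr1, mul_nonneg (mul_nonneg _hy _hr1) _hr1,
    mul_nonneg (mul_nonneg (mul_nonneg (mul_nonneg _hhy _hhy) _hhy) _ha1) _ha1,
    mul_nonneg (mul_nonneg (mul_nonneg (mul_nonneg _hhy _hhy) _hhy) _ha1) _ha2,
    mul_nonneg (mul_nonneg (mul_nonneg (mul_nonneg _hhy _hhy) _hu1) _ha1) _ha2,
    mul_nonneg (mul_nonneg (mul_nonneg (mul_nonneg _hhy _hhy) _hu1) _ha2) _ha2, mul_nonneg (mul_nonneg (mul_nonneg _hhy _hhy) _hv1) _ha1,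
    mul_nonneg (mul_nonneg (mul_nonneg (mul_nonneg _hhy _hhy) _hu2) _ha1) _ha2,
    mul_nonneg (mul_nonneg (mul_nonneg (mul_nonneg _hhy _hhy) _ha1) _hb1) _ha2, mul_nonneg (mul_nonneg (mul_nonneg _hhy _hhy) _ha1) _ht2,
    mul_nonneg (mul_nonneg (mul_nonneg _hhy _hu1) _hv1) _ha1, mul_nonneg (mul_nonneg (mul_nonneg _hhy _hu1) _hv1) _ha2,
    mul_nonneg (mul_nonneg (mul_nonneg _hhy _hu1) _ha2) _ht2, mul_nonneg (mul_nonneg (mul_nonneg _hhy _hv1) _hv1) _ht2,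
    mul_nonneg (mul_nonneg (mul_nonneg _hhy _hv1) _hu2) _ha1, mul_nonneg (mul_nonneg (mul_nonneg _hhy _hv1) _hv2) _hb2,
    mul_nonneg (mul_nonneg (mul_nonneg _hhy _hv1) _hv2) _ht2, mul_nonneg (mul_nonneg (mul_nonneg _hhy _hv1) _ha1) _hb2,
    mul_nonneg (mul_nonneg (mul_nonneg _hhy _hv1) _ha1) _ht2, mul_nonneg (mul_nonneg (mul_nonneg _hhy _hv1) _ha1) _hr1,
    mul_nonneg (mul_nonneg _hhy _hv1) _hr1, mul_nonneg (mul_nonneg (mul_nonneg _hhy _hu2) _ha2) _ha2,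
    mul_nonneg (mul_nonneg (mul_nonneg _hhy _hv2) _hv2) _ht2, mul_nonneg (mul_nonneg (mul_nonneg _hhy _hv2) _ha1) _ht2,
    mul_nonneg (mul_nonneg _hhy _hv2) _ht2, mul_nonneg (mul_nonneg (mul_nonneg _hhy _ha1) _hb1) _ha2,
    mul_nonneg (mul_nonneg (mul_nonneg _hhy _ha1) _hb2) _ht2, mul_nonneg (mul_nonneg _hhy _ha1) _ht2, mul_nonneg (mul_nonneg _hhy _ha1) _hr1,
    mul_nonneg (mul_nonneg _hhy _ha2) _hr1, mul_nonneg (mul_nonneg _hu1 _hv1) _hv1, mul_nonneg (mul_nonneg _hu1 _hv1) _hv2,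
    mul_nonneg (mul_nonneg _hu1 _hv1) _ha1, mul_nonneg (mul_nonneg _hu1 _ht1) _hr1, mul_nonneg (mul_nonneg _hu1 _hr1) _hr1,
    mul_nonneg (mul_nonneg _hv1 _hv1) _hu2, mul_nonneg (mul_nonneg _hv1 _hv1) _hr1, mul_nonneg (mul_nonneg _hv1 _hu2) _hv2,
    mul_nonneg (mul_nonneg _hv1 _hu2) _ha1, mul_nonneg (mul_nonneg _hv1 _hv2) _hr1, mul_nonneg _hv1 _ha1, mul_nonneg _hv1 _ht2, mul_nonneg _hv1 _hr1,
    mul_nonneg (mul_nonneg _hu2 _ha1) _ht2, mul_nonneg (mul_nonneg _hu2 _ha2) _ht2, mul_nonneg (mul_nonneg _hv2 _hv2) _hb1,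
    mul_nonneg (mul_nonneg _hv2 _hv2) _hr1, mul_nonneg (mul_nonneg _hv2 _ha1) _hr1, mul_nonneg (mul_nonneg _hv2 _hb2) _hr1,
    mul_nonneg (mul_nonneg _ha1 _ha1) _hb1, mul_nonneg (mul_nonneg _ha1 _hb1) _ht2, mul_nonneg (mul_nonneg _ha1 _hb2) _hr1, mul_nonneg _ha1 _hr1,
    mul_nonneg (mul_nonneg _hb1 _ha2) _ha2, mul_nonneg (mul_nonneg _ha2 _hb2) _ht2, mul_nonneg (mul_nonneg _ha2 _hr1) _hr1]

set_option maxHeartbeats 1000000 in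
set_option maxRecDepth 8192 in
/-- Two-big cell `HL/C3`, block 0: Handelman support (31 products; kit LP; split polynomial rounded to denominators ≤ 256). [this work] -/
theorem tbcBlock_HL_C3_0 (y u₁ v₁ u₂ v₂ : ℝ) (_hy : 0 ≤ y) (_hhy : 0 ≤ 1 / 2 - y) (_hu1 : 0 ≤ u₁) (_hv1 : 0 ≤ v₁) (_hu2 : 0 ≤ u₂) (_hv2 : 0 ≤ v₂)
    (_ha1 : 0 ≤ 1 - u₁ - v₁) (_hb1 : 0 ≤ u₁ + v₁ - 1 / 2) (_ha2 : 0 ≤ 1 - u₂ - v₂) (_hb2 : 0 ≤ u₂ + v₂ - 1 / 2) (_ht1 : 0 ≤ u₁ * y - (1 - y) * v₁)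
    (_ht2 : 0 ≤ (1 - y) * v₂ - u₂ * y) (_hr1 : 0 ≤ (2 - y) * (1 - u₁ - v₁) - (2 - u₁ - u₂)) :
    117 / 256 * v₁ * u₂ + 59 / 128 * v₁ * v₂ + y * u₁ * v₂ - y * v₁ * u₂ - y * v₁ * v₂ - y ^ 2 * u₁ * u₂ - y ^ 2 * u₁ * v₂ + 13 / 128 * y + 11 / 16 *
          y ^ 2 - 85 / 128 * y * u₁ + 63 / 256 * y * v₁ - 9 / 256 * y * u₂ - 1 / 2 * y * v₂ - 3 / 32 * v₁ + 3 / 128 * u₁ * v₁ - 1 / 16 * v₁ ^ 2 ≤ (0 :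
          ℝ) := by
  linarith [
    mul_nonneg (mul_nonneg (mul_nonneg _hy _hy) _hu2) _hb1, mul_nonneg (mul_nonneg _hy _hy) _hv2, mul_nonneg (mul_nonneg _hy _hy) _hb1,
    mul_nonneg (mul_nonneg _hy _hy) _hb2, mul_nonneg (mul_nonneg _hy _hhy) _hv1, mul_nonneg (mul_nonneg (mul_nonneg _hy _hhy) _hb1) _ha2,
    mul_nonneg (mul_nonneg _hy _hhy) _ha2, mul_nonneg (mul_nonneg (mul_nonneg _hy _hhy) _ha2) _ha2, mul_nonneg (mul_nonneg _hy _hu1) _hr1,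
    mul_nonneg (mul_nonneg _hy _hv1) _hv2, mul_nonneg (mul_nonneg _hy _hv1) _hb2, mul_nonneg (mul_nonneg _hy _hv1) _ht2,
    mul_nonneg (mul_nonneg (mul_nonneg _hy _hu2) _hu2) _hb1, mul_nonneg (mul_nonneg _hy _hu2) _hb1,
    mul_nonneg (mul_nonneg (mul_nonneg _hy _hu2) _hb1) _ha2, mul_nonneg (mul_nonneg (mul_nonneg _hy _hv2) _hv2) _ha1,
    mul_nonneg (mul_nonneg (mul_nonneg _hy _hv2) _ha1) _ha2, mul_nonneg (mul_nonneg _hy _hv2) _hr1, mul_nonneg (mul_nonneg _hy _ha1) _ht2,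
    mul_nonneg (mul_nonneg (mul_nonneg _hy _hb1) _ha2) _ha2, mul_nonneg (mul_nonneg _hy _ha2) _ht2, mul_nonneg (mul_nonneg _hy _ha2) _hr1,
    mul_nonneg _hy _hr1, mul_nonneg (mul_nonneg _hhy _hu1) _ht1, mul_nonneg (mul_nonneg _hhy _hv1) _ha2, mul_nonneg _hhy _ht1, mul_nonneg _hu1 _ht1,
    mul_nonneg _hv1 _hv1, mul_nonneg _hv2 _ht1, mul_nonneg _hb2 _ht1, _ht1]

set_option maxHeartbeats 1000000 in
/-- **Two-big cell `HL/C3`**: the reduced inequality from the three blocks (items in product form `N ≤ t·D`). [this work] -/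
theorem tbcCell_HL_C3 (y u₁ v₁ u₂ v₂ t₁ t₂ t₀ : ℝ) (hy0 : 0 < y) (hhy : y ≤ 1 / 2) (hu1 : 0 ≤ u₁) (hv1 : 0 ≤ v₁) (hu2 : 0 ≤ u₂) (hv2 : 0 ≤ v₂)
    (ha1 : u₁ + v₁ ≤ 1) (hb1 : 1 / 2 ≤ u₁ + v₁) (ha2 : u₂ + v₂ ≤ 1) (hb2 : 1 / 2 ≤ u₂ + v₂) (ht1 : 0 ≤ u₁ * y - (1 - y) * v₁)
    (ht2 : 0 ≤ (1 - y) * v₂ - u₂ * y) (hr1 : 0 ≤ (2 - y) * (1 - u₁ - v₁) - (2 - u₁ - u₂)) (hct : 0 < (2 - u₁ - u₂))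
    (hT1 : ((1 - y) * (1 + v₁ - u₂)) ≤ t₁ * ((2 - u₁ - u₂) - (1 - y) * (1 - u₁ - v₁)))
    (hT2 : (1 + v₂ - u₁) ^ 2 ≤ t₂ * (y * (2 - u₁ - u₂) + (1 + v₂ - u₁) ^ 2)) (hT0 : 0 ≤ t₀) :
    (1 - y) * ((u₁ + v₁) * (u₂ + v₂))
      ≤ u₁ * ((u₂ + v₂) * (1 - y) ^ 2 + y * u₂) + u₁ * (y * ((u₂ + v₂) * (2 - y) - u₂)) * t₁ + v₁ * ((u₂ + v₂) * (1 - y) ^ 2 + y * u₂) * t₂ + v₁ * (y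
            * ((u₂ + v₂) * (2 - y) - u₂)) * t₀ := by
  have b1 := tbcBlock_HL_C3_1 y u₁ v₁ u₂ v₂ hy0.le (by linarith) hu1 hv1 hu2 hv2 (by linarith) (by linarith) (by linarith) (by linarith) ht1 ht2 hr1
  have b2 := tbcBlock_HL_C3_2 y u₁ v₁ u₂ v₂ hy0.le (by linarith) hu1 hv1 hu2 hv2 (by linarith) (by linarith) (by linarith) (by linarith) ht1 ht2 hr1
  have b0 := tbcBlock_HL_C3_0 y u₁ v₁ u₂ v₂ hy0.le (by linarith) hu1 hv1 hu2 hv2 (by linarith) (by linarith) (by linarith) (by linarith) ht1 ht2 hr1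
  have hD1 : (0:ℝ) < ((2 - u₁ - u₂) - (1 - y) * (1 - u₁ - v₁)) := by
    have h1 := mul_pos hy0 hct
    have h2 : (0:ℝ) ≤ (1 - y) * (1 + v₁ - u₂) := mul_nonneg (by linarith) (by linarith)
    linarith
  have hD2 : (0:ℝ) < (y * (2 - u₁ - u₂) + (1 + v₂ - u₁) ^ 2) := by
    have h1 := mul_pos hy0 hct
    have h2 := sq_nonneg (1 + v₂ - u₁)
    linarith
  have hP1 : (0:ℝ) ≤ u₁ := hu1
  have hQ1 : (0:ℝ) ≤ v₁ := hv1
  have hP2 : (0:ℝ) ≤ ((u₂ + v₂) * (1 - y) ^ 2 + y * u₂) := by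
    have h1 := mul_nonneg (show (0:ℝ) ≤ u₂ + v₂ by linarith) (sq_nonneg (1 - y))
    have h2 := mul_nonneg hy0.le hu2
    linarith
  have hQt2 : (0:ℝ) ≤ ((u₂ + v₂) * (2 - y) - u₂) := by
    have h1 := mul_nonneg (show (0:ℝ) ≤ 1 - y by linarith) (show (0:ℝ) ≤ u₂ + v₂ by linarith)
    linarith
  have hQ2 : (0:ℝ) ≤ (y * ((u₂ + v₂) * (2 - y) - u₂)) := mul_nonneg hy0.le hQt2
  have hBF1 : (0:ℝ) ≤ (u₁ * ((u₂ + v₂) * (2 - y) - u₂)) := mul_nonneg hP1 hQt2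
  have k1 : (-13 / 128 - 11 / 16 * y + 85 / 128 * u₁ + 71 / 256 * v₁ + 9 / 256 * u₂ + 1 / 2 * v₂) ≤ (u₁ * ((u₂ + v₂) * (2 - y) - u₂)) * t₁ :=
        tbc_block_le _ _ _ _ _ hBF1 hD1 hT1 b1
  have hBF2 : (0:ℝ) ≤ ((u₂ + v₂) * (1 - y) ^ 2 + y * u₂) := hP2
  have k2 : (3 / 32 - 67 / 128 * y - 3 / 128 * u₁ + 1 / 16 * v₁ + 139 / 256 * u₂ + 69 / 128 * v₂) ≤ ((u₂ + v₂) * (1 - y) ^ 2 + y * u₂) * t₂ :=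
        tbc_block_le _ _ _ _ _ hBF2 hD2 hT2 b2
  have hB0 : (0:ℝ) ≤ (v₁ * (y * ((u₂ + v₂) * (2 - y) - u₂))) := mul_nonneg hQ1 hQ2
  have k0 : (117 / 256 * v₁ * u₂ + 59 / 128 * v₁ * v₂ + y * u₁ * v₂ - y * v₁ * u₂ - y * v₁ * v₂ - y ^ 2 * u₁ * u₂ - y ^ 2 * u₁ * v₂ + 13 / 128 * y +
        11 / 16 * y ^ 2 - 85 / 128 * y * u₁ + 63 / 256 * y * v₁ - 9 / 256 * y * u₂ - 1 / 2 * y * v₂ - 3 / 32 * v₁ + 3 / 128 * u₁ * v₁ - 1 / 16 * v₁ ^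
        2) ≤ (v₁ * (y * ((u₂ + v₂) * (2 - y) - u₂))) * t₀ := b0.trans (mul_nonneg hB0 hT0)
  have e : (-13 / 128 * y - 11 / 16 * y ^ 2 + 85 / 128 * y * u₁ + 71 / 256 * y * v₁ + 9 / 256 * y * u₂ + 1 / 2 * y * v₂) + (3 / 32 * v₁ - 67 / 128 * y
        * v₁ - 3 / 128 * u₁ * v₁ + 1 / 16 * v₁ ^ 2 + 139 / 256 * v₁ * u₂ + 69 / 128 * v₁ * v₂) + (117 / 256 * v₁ * u₂ + 59 / 128 * v₁ * v₂ + y * u₁ *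
        v₂ - y * v₁ * u₂ - y * v₁ * v₂ - y ^ 2 * u₁ * u₂ - y ^ 2 * u₁ * v₂ + 13 / 128 * y + 11 / 16 * y ^ 2 - 85 / 128 * y * u₁ + 63 / 256 * y * v₁ -
        9 / 256 * y * u₂ - 1 / 2 * y * v₂ - 3 / 32 * v₁ + 3 / 128 * u₁ * v₁ - 1 / 16 * v₁ ^ 2) = (1 - y) * ((u₁ + v₁) * (u₂ + v₂)) - u₁ * ((u₂ + v₂) *
        (1 - y) ^ 2 + y * u₂) := by ring
  have k1F := mul_le_mul_of_nonneg_left k1 hy0.le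
  have ec1 : y * (-13 / 128 - 11 / 16 * y + 85 / 128 * u₁ + 71 / 256 * v₁ + 9 / 256 * u₂ + 1 / 2 * v₂) = -13 / 128 * y - 11 / 16 * y ^ 2 + 85 / 128 *
        y * u₁ + 71 / 256 * y * v₁ + 9 / 256 * y * u₂ + 1 / 2 * y * v₂ := by ring
  have eb1 : y * ((u₁ * ((u₂ + v₂) * (2 - y) - u₂)) * t₁) = u₁ * (y * ((u₂ + v₂) * (2 - y) - u₂)) * t₁ := by ring
  have kk1 : (-13 / 128 * y - 11 / 16 * y ^ 2 + 85 / 128 * y * u₁ + 71 / 256 * y * v₁ + 9 / 256 * y * u₂ + 1 / 2 * y * v₂) ≤ u₁ * (y * ((u₂ + v₂) * (2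
        - y) - u₂)) * t₁ := by rw [← ec1, ← eb1]; exact k1F
  have k2F := mul_le_mul_of_nonneg_left k2 hv1
  have ec2 : v₁ * (3 / 32 - 67 / 128 * y - 3 / 128 * u₁ + 1 / 16 * v₁ + 139 / 256 * u₂ + 69 / 128 * v₂) = 3 / 32 * v₁ - 67 / 128 * y * v₁ - 3 / 128 *
        u₁ * v₁ + 1 / 16 * v₁ ^ 2 + 139 / 256 * v₁ * u₂ + 69 / 128 * v₁ * v₂ := by ring
  have eb2 : v₁ * (((u₂ + v₂) * (1 - y) ^ 2 + y * u₂) * t₂) = v₁ * ((u₂ + v₂) * (1 - y) ^ 2 + y * u₂) * t₂ := by ring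
  have kk2 : (3 / 32 * v₁ - 67 / 128 * y * v₁ - 3 / 128 * u₁ * v₁ + 1 / 16 * v₁ ^ 2 + 139 / 256 * v₁ * u₂ + 69 / 128 * v₁ * v₂) ≤ v₁ * ((u₂ + v₂) * (1
        - y) ^ 2 + y * u₂) * t₂ := by rw [← ec2, ← eb2]; exact k2F
  have hsum := add_le_add (add_le_add kk1 kk2) k0
  calc (1 - y) * ((u₁ + v₁) * (u₂ + v₂)) = u₁ * ((u₂ + v₂) * (1 - y) ^ 2 + y * u₂) + ((-13 / 128 * y - 11 / 16 * y ^ 2 + 85 / 128 * y * u₁ + 71 / 256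
        * y * v₁ + 9 / 256 * y * u₂ + 1 / 2 * y * v₂) + (3 / 32 * v₁ - 67 / 128 * y * v₁ - 3 / 128 * u₁ * v₁ + 1 / 16 * v₁ ^ 2 + 139 / 256 * v₁ * u₂ +
        69 / 128 * v₁ * v₂) + (117 / 256 * v₁ * u₂ + 59 / 128 * v₁ * v₂ + y * u₁ * v₂ - y * v₁ * u₂ - y * v₁ * v₂ - y ^ 2 * u₁ * u₂ - y ^ 2 * u₁ * v₂
        + 13 / 128 * y + 11 / 16 * y ^ 2 - 85 / 128 * y * u₁ + 63 / 256 * y * v₁ - 9 / 256 * y * u₂ - 1 / 2 * y * v₂ - 3 / 32 * v₁ + 3 / 128 * u₁ * v₁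
        - 1 / 16 * v₁ ^ 2)) := by rw [e]; ring
    _ ≤ u₁ * ((u₂ + v₂) * (1 - y) ^ 2 + y * u₂) + (u₁ * (y * ((u₂ + v₂) * (2 - y) - u₂)) * t₁ + v₁ * ((u₂ + v₂) * (1 - y) ^ 2 + y * u₂) * t₂ + v₁ * (y
          * ((u₂ + v₂) * (2 - y) - u₂)) * t₀) := add_le_add le_rfl hsum
    _ = _ := by ring

end IndepBlob

end Quant

end Summit.CriticalPhenomena.PercolationContinuityZ3.Theorems
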